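import Mathlib
import Summits.QuantumFields.YangMills.Theses.GuardedThresholdRemoval
import Summits.QuantumFields.YangMills.Theorems.SpecificationCompactnessHeightZeroDensityBridge

/-!
# `UnitLawCollarDominated` (route GuardedThresholdRemoval, crux r201, stmt-QuantumFields-28045) ⇐ the height-zero clause of the tree's
# heightwise `K`-uniform upper stability schema — the SAME Bałaban-facing input as `UnitDensityUI` of route SpecificationCompactness

`T3HeightwiseDensityBounds.HeightwiseUpperBound F γ` at height `n = 0` is a `K`-UNIFORM a.e. bound `Z_K⁻¹ρ̂_K ≤ C(F, γ)` on the normalised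
renormalised unit density ([Balaban1985UV3] Thm 1: (5) at `k = K` over (6), quotient reading — typed in the tree, NOT asserted).  By the bridge
`…HeightZeroDensityBridge` (`D_{0,K} = A_K`, `unitLaw_le_smul_of_heightZeroBound`) it dominates the unit laws by product Haar, `unitLaw_K ≤ C·dU`,
for EVERY `K` and EVERY measurable set — in particular on the guard collars, which is `UnitLawCollarDominated` (with `η₀ := 1`, `K₀ := 0`).
So the two R3 lines GuardedThresholdRemoval (crux 28045) and SpecificationCompactness (crux 28251 `UnitDensityUI`,
`unitDensityUI_of_heightwiseUpperBound`) hang on ONE tree schema clause.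

HONEST FRAMING.  A door from a hypothesis schema to the crux (conditional; credits nothing by itself); rung R3 RECORD line; nothing about
`ContinuumYM3Torus` or the YM mass gap is proved.
-/

noncomputable section

namespace Summit.QuantumFields.YangMills.Theorems.SpecificationCompactnessKernel

open MeasureTheory Filter Topology
open Literature.MathematicalPhysics.QuantumFieldTheory.Balaban1983to89
open Literature.MathematicalPhysics.QuantumFieldTheory.Balaban1983to89.T3ContinuumYM3Torus
open Literature.MathematicalPhysics.QuantumFieldTheory.Balaban1983to89.Missing
open Literature.MathematicalPhysics.QuantumFieldTheory.Balaban1983to89.T4Continuum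
open Literature.MathematicalPhysics.QuantumFieldTheory.Balaban1983to89.T3ThresholdRemoval
open Literature.MathematicalPhysics.QuantumFieldTheory.Balaban1983to89.T3UnitLawDensityEML
open Literature.MathematicalPhysics.QuantumFieldTheory.Balaban1983to89.T3HeightwiseDensityBounds

/-- **`UnitLawCollarDominated` ⇐ the heightwise upper stability schema with a coupling threshold** (only its height-zero clause is used;
`η₀ := 1`, `K₀ := 0`, `C := max C₀ 0`; the collar restriction is not needed). [cite: Balaban1985UV3, Thm 1 p.257, (5)-(6) pp.256-257] -/
theorem unitLawCollarDominated_of_heightwiseUpperBound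
    (h : ∃ γ₂ : ℝ, 0 < γ₂ ∧ ∀ (F : T3Family) (γ : ℝ), 0 < γ → γ ≤ γ₂ → HeightwiseUpperBound F γ) :
    Summit.QuantumFields.YangMills.Theses.GuardedThresholdRemoval.UnitLawCollarDominated := by
  obtain ⟨γ₂, hγ₂, hH⟩ := h
  refine ⟨γ₂, hγ₂, fun F γ hγ hle => ?_⟩
  obtain ⟨C, hC⟩ := (hH F γ hγ hle) 0
  refine ⟨1, one_pos, max C 0, 0, fun K _ S _ => ?_⟩
  have hdom := unitLaw_le_smul_of_heightZeroBound F hγ.le (C := max C 0)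
    (fun K hK => (hC K hK).mono fun V hV => hV.trans (le_max_left _ _)) K
  have h1 : F.unitLaw ℰp measurableE_ℰp γ K S ≤
      ENNReal.ofReal (max C 0) * fieldMeasure (F.P 0) 0 (Matrix.specialUnitaryGroup (Fin 2) ℂ) S := by
    have := (Measure.le_iff'.1 hdom) S
    simpa [Measure.smul_apply] using this
  haveI : IsProbabilityMeasure (fieldMeasure (F.P 0) 0 (Matrix.specialUnitaryGroup (Fin 2) ℂ)) :=
    Missing.isProbabilityMeasure_fieldMeasure (F.P 0) 0
  have hfin : ENNReal.ofReal (max C 0) * fieldMeasure (F.P 0) 0 (Matrix.specialUnitaryGroup (Fin 2) ℂ) S ≠ ⊤ :=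
    ENNReal.mul_ne_top ENNReal.ofReal_ne_top (measure_ne_top _ _)
  show (F.unitLaw ℰp measurableE_ℰp γ K S).toReal ≤
    max C 0 * (fieldMeasure (F.P 0) 0 (Matrix.specialUnitaryGroup (Fin 2) ℂ) S).toReal
  calc (F.unitLaw ℰp measurableE_ℰp γ K S).toReal
      ≤ (ENNReal.ofReal (max C 0) * fieldMeasure (F.P 0) 0 (Matrix.specialUnitaryGroup (Fin 2) ℂ) S).toReal :=
        ENNReal.toReal_mono hfin h1
    _ = max C 0 * (fieldMeasure (F.P 0) 0 (Matrix.specialUnitaryGroup (Fin 2) ℂ) S).toReal := by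
        rw [ENNReal.toReal_mul, ENNReal.toReal_ofReal (le_max_right _ _)]

end Summit.QuantumFields.YangMills.Theorems.SpecificationCompactnessKernel

end
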